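import Summits.Parity.GeneralizedHardyLittlewood.Theorems.PrimeLevelFamEdgeMomentsBeyondDiagonalDiagRemOneThreeMonomials
import Summits.Parity.GeneralizedHardyLittlewood.Theorems.PrimeLevelFamEdgeMomentsBeyondDiagonalDiagRemOneThreeBose
import HarnessLib

/-!
# Route `PrimeLevelFamEdge`, crux K_A `MomentsBeyondDiagonal` (stmt-Parity-20007), line «petersson_layers» v4, stub `stub_diag`:
# **the inner `(k₁,k₂)` sum of the ORDER-`(1,3)` remainder estimate (R₁₃), for fixed Selberg coordinates `(c,g)`** (brick B4)

Brick B4 of (R₁₃) — the hypothesis `hR` of `…DiagDecorOrderOneThreeTarget.orderOneThree_target_of_remainder` (p831701).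
The order-`(2,2)` inner file `…DiagRemTwoTwoInner` (p831617) re-run for the eight continued Bose remainders `r_ab`, `a ≤ 1`,
`b ≤ 3` (`…DiagRemOneThreeBose.twoSeq_eight₁₃`: one set of constants) and the Hecke-summed weight of order `(1,3)`
(`…DiagDecorOrderRungThreeHecke.heckeSum_orderOneThree_eq`)

  `Wt₁₃ = (L⁴ − 3S₂² + 2S₄)/16·r₀₀ + (3L³ − 3LS₂)/8·r₀₁ + (3L² − 3S₂)/4·r₀₂ + L/2·r₀₃ + (L³ + 3LS₂)/8·r₁₀ + (3L² + 3S₂)/4·r₁₁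
         + 3L/2·r₁₂ + r₁₃`,

`L = 2(log Q − log g) − log k₁ − log k₂`, `S_m = P_m(k₁) + P_m(k₂)`, `P_m(k) = Σ_{p∣k} log^m p`, through the abstract bookkeeping
`…DiagRemOneThreeMonomials.abs_profile_weight_le₁₃` with the SAME four envelopes as order `(2,2)`: undecorated (`Λ⁴·Λ²·x⁶`),
`P₂`-column (`Λ²·Λ⁴·x⁶`), `3P₂²−2P₄`-column (`Λ⁶·x⁶`), both-sided (`Λ⁴·x⁶·D + x⁶·D²`) — the homogeneous weight is `4` again, so
every log-saving term is `≤ Λ¹²·D(n)²/(1+log K₁)¹²`, the budget of (R₁₃) (`= C·log q̂`), and the closing real inequality is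
`…DiagRemTwoTwoEnvelopes.envelope_arith₂₂` verbatim.

* `abs_inner_rem_le₁₃` — **the inner estimate**: for `n, g ≥ 1`, `Q, M ≥ 2`, `n, g ≤ M`, `Y = M/n`, `α = g²/Q²`, `2αK₁Y ≤ 1`:
  `|Σ_{k₁,k₂≤Y} a_n(k₁)P(ℓ⁺₁/log M)a_n(k₂)P(ℓ⁺₂/log M)·Wt₁₃(k₁,k₂)| ≤ C·D(n)²·Λ¹²·(√(2αK₁Y) + (1+log K₁)⁻¹²)`,
  `Λ = 1 + 2log M + log Q`, with the moments `μ₂ = ∫₀¹log²v·v/(1+v²)²`, `μ₄ = ∫₀¹log⁴v·v/(1+v²)²`.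

Def-free; theorems only. Helper `--supports stmt-Parity-20007`; closes nothing (brick B5 = assembly of (R₁₃) remains; the order
`(3,3)` and `stub_rung/core/band/identP` remain); K_A, K_B and the Parity summit are NOT proved; nothing about Landau–Siegel zeros.

## References
* E. Kowalski, P. Michel, J. VanderKam, J. reine angew. Math. 526 (2000), (22)–(28) pp. 12–15 and Prop. 5.1 p. 18.
  [cite: KowalskiMichelVanderKam2000, (23)–(28) and Prop. 5.1 — derivation (order-(1,3) remainder, inner sums)]
-/

noncomputable section

open scoped Real ArithmeticFunction.Moebius
open Finset ArithmeticFunction Polynomial Real MeasureTheory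

namespace Summit.Parity.GeneralizedHardyLittlewood.Theorems.MomentsBeyondDiagonal.DiagCorner

open Literature.NumberTheory.LFunctions Literature.NumberTheory.LFunctions.KMV2000
open MollifierMainTerm (W)
open Summit.Parity.GeneralizedHardyLittlewood.Theorems.BeyondDiagonalBeatsQuarter.KernelFormXSq
  (copTauW copTauW_apply divWeight divWeight_nonneg one_le_divWeight abs_W_le)
open Summit.Parity.GeneralizedHardyLittlewood.Theorems.BeyondDiagonalBeatsQuarter.Corner
open Summit.Parity.GeneralizedHardyLittlewood.Theorems.MomentsBeyondDiagonal.DiagLines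

set_option maxHeartbeats 3200000 in
-- eight remainders, four decoration types, large statement
/-- **The inner `(k₁,k₂)` sum of the order-`(1,3)` remainder estimate (R₁₃) for fixed `(c,g)`** (see the module docstring).
[cite: KowalskiMichelVanderKam2000, (23)–(28) and Prop. 5.1 — derivation (order-(1,3) remainder, inner sums)] -/
theorem abs_inner_rem_le₁₃ : ∃ E₀₀ E₀₁ E₀₂ E₀₃ E₁₀ E₁₁ E₁₂ E₁₃ μ₂ μ₄ : ℝ, ∀ P : ℝ[X], P.coeff 0 = 0 → ∃ C : ℝ, 0 < C ∧
    ∀ (n g : ℕ), n ≠ 0 → g ≠ 0 → ∀ (Q M : ℝ), 2 ≤ Q → 2 ≤ M → (n : ℝ) ≤ M → (g : ℝ) ≤ M → ∀ K₁ : ℕ,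
      2 * ((g : ℝ) ^ 2 / Q ^ 2) * K₁ * (M / n) ≤ 1 →
    |∑ k₁ ∈ Icc 1 ⌊M / n⌋₊, ∑ k₂ ∈ Icc 1 ⌊M / n⌋₊,
        copTauW n k₁ * P.eval (ellp (M / n) k₁ / Real.log M) * (copTauW n k₂ * P.eval (ellp (M / n) k₂ / Real.log M)) *
          ((((2 * (Real.log Q - Real.log g) - Real.log k₁ - Real.log k₂) ^ 4 -
                3 * ((∑ p ∈ k₁.primeFactors, Real.log p ^ 2) + ∑ p ∈ k₂.primeFactors, Real.log p ^ 2) ^ 2 +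
                2 * ((∑ p ∈ k₁.primeFactors, Real.log p ^ 4) + ∑ p ∈ k₂.primeFactors, Real.log p ^ 4)) / 16 *
              ((∫ u₁ in Set.Ioi (0 : ℝ), ∫ u₂ in Set.Ioi (((g : ℝ) ^ 2 / Q ^ 2 * k₁ * k₂) / u₁),
              Real.exp (-(u₁ + u₂)) / (1 - Real.exp (-(u₁ + u₂))) ^ 2) -
            (Real.log (1 / ((g : ℝ) ^ 2 / Q ^ 2 * k₁ * k₂)) / 2 + E₀₀)) +
            (3 * (2 * (Real.log Q - Real.log g) - Real.log k₁ - Real.log k₂) ^ 3 -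
                3 * (2 * (Real.log Q - Real.log g) - Real.log k₁ - Real.log k₂) * ((∑ p ∈ k₁.primeFactors, Real.log p ^ 2) + ∑ p ∈ k₂.primeFactors, Real.log p ^ 2)) / 8 *
              ((∫ u₁ in Set.Ioi (0 : ℝ), ∫ u₂ in Set.Ioi (((g : ℝ) ^ 2 / Q ^ 2 * k₁ * k₂) / u₁),
              Real.exp (-(u₁ + u₂)) / (1 - Real.exp (-(u₁ + u₂))) ^ 2 * Real.log u₂) -
            (-(Real.log (1 / ((g : ℝ) ^ 2 / Q ^ 2 * k₁ * k₂)) ^ 2) / 8 + E₀₁)) +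
            (3 * (2 * (Real.log Q - Real.log g) - Real.log k₁ - Real.log k₂) ^ 2 -
                3 * ((∑ p ∈ k₁.primeFactors, Real.log p ^ 2) + ∑ p ∈ k₂.primeFactors, Real.log p ^ 2)) / 4 *
              ((∫ u₁ in Set.Ioi (0 : ℝ), ∫ u₂ in Set.Ioi (((g : ℝ) ^ 2 / Q ^ 2 * k₁ * k₂) / u₁),
              Real.exp (-(u₁ + u₂)) / (1 - Real.exp (-(u₁ + u₂))) ^ 2 * Real.log u₂ ^ 2) -
            (Real.log (1 / ((g : ℝ) ^ 2 / Q ^ 2 * k₁ * k₂)) ^ 3 / 24 + 2 * μ₂ * Real.log (1 / ((g : ℝ) ^ 2 / Q ^ 2 * k₁ * k₂)) + E₀₂)) +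
            (2 * (Real.log Q - Real.log g) - Real.log k₁ - Real.log k₂) / 2 *
              ((∫ u₁ in Set.Ioi (0 : ℝ), ∫ u₂ in Set.Ioi (((g : ℝ) ^ 2 / Q ^ 2 * k₁ * k₂) / u₁),
              Real.exp (-(u₁ + u₂)) / (1 - Real.exp (-(u₁ + u₂))) ^ 2 * Real.log u₂ ^ 3) -
            (-(Real.log (1 / ((g : ℝ) ^ 2 / Q ^ 2 * k₁ * k₂)) ^ 4) / 64 - 3 * μ₂ / 2 * Real.log (1 / ((g : ℝ) ^ 2 / Q ^ 2 * k₁ * k₂)) ^ 2 + E₀₃)) +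
            ((2 * (Real.log Q - Real.log g) - Real.log k₁ - Real.log k₂) ^ 3 +
                3 * (2 * (Real.log Q - Real.log g) - Real.log k₁ - Real.log k₂) * ((∑ p ∈ k₁.primeFactors, Real.log p ^ 2) + ∑ p ∈ k₂.primeFactors, Real.log p ^ 2)) / 8 *
              ((∫ u₁ in Set.Ioi (0 : ℝ), Real.log u₁ * ∫ u₂ in Set.Ioi (((g : ℝ) ^ 2 / Q ^ 2 * k₁ * k₂) / u₁),
              Real.exp (-(u₁ + u₂)) / (1 - Real.exp (-(u₁ + u₂))) ^ 2) -
            (-(Real.log (1 / ((g : ℝ) ^ 2 / Q ^ 2 * k₁ * k₂)) ^ 2) / 8 + E₁₀)) +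
            (3 * (2 * (Real.log Q - Real.log g) - Real.log k₁ - Real.log k₂) ^ 2 +
                3 * ((∑ p ∈ k₁.primeFactors, Real.log p ^ 2) + ∑ p ∈ k₂.primeFactors, Real.log p ^ 2)) / 4 *
              ((∫ u₁ in Set.Ioi (0 : ℝ), Real.log u₁ * ∫ u₂ in Set.Ioi (((g : ℝ) ^ 2 / Q ^ 2 * k₁ * k₂) / u₁),
              Real.exp (-(u₁ + u₂)) / (1 - Real.exp (-(u₁ + u₂))) ^ 2 * Real.log u₂) -
            (Real.log (1 / ((g : ℝ) ^ 2 / Q ^ 2 * k₁ * k₂)) ^ 3 / 24 - 2 * μ₂ * Real.log (1 / ((g : ℝ) ^ 2 / Q ^ 2 * k₁ * k₂)) + E₁₁)) +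
            3 * (2 * (Real.log Q - Real.log g) - Real.log k₁ - Real.log k₂) / 2 *
              ((∫ u₁ in Set.Ioi (0 : ℝ), Real.log u₁ * ∫ u₂ in Set.Ioi (((g : ℝ) ^ 2 / Q ^ 2 * k₁ * k₂) / u₁),
              Real.exp (-(u₁ + u₂)) / (1 - Real.exp (-(u₁ + u₂))) ^ 2 * Real.log u₂ ^ 2) -
            (-(Real.log (1 / ((g : ℝ) ^ 2 / Q ^ 2 * k₁ * k₂)) ^ 4) / 64 + μ₂ / 2 * Real.log (1 / ((g : ℝ) ^ 2 / Q ^ 2 * k₁ * k₂)) ^ 2 + E₁₂)) +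
            ((∫ u₁ in Set.Ioi (0 : ℝ), Real.log u₁ * ∫ u₂ in Set.Ioi (((g : ℝ) ^ 2 / Q ^ 2 * k₁ * k₂) / u₁),
              Real.exp (-(u₁ + u₂)) / (1 - Real.exp (-(u₁ + u₂))) ^ 2 * Real.log u₂ ^ 3) -
            (Real.log (1 / ((g : ℝ) ^ 2 / Q ^ 2 * k₁ * k₂)) ^ 5 / 160 - 2 * μ₄ * Real.log (1 / ((g : ℝ) ^ 2 / Q ^ 2 * k₁ * k₂)) + E₁₃))))| ≤
      C * divWeight n ^ 2 *
        ((1 + 2 * Real.log M + Real.log Q) ^ 12 * Real.sqrt (2 * ((g : ℝ) ^ 2 / Q ^ 2) * K₁ * (M / n)) +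
          (1 + 2 * Real.log M + Real.log Q) ^ 12 / (1 + Real.log K₁) ^ 12) := by
  obtain ⟨E₀₀, E₀₁, E₁₀, E₀₂, E₁₁, E₁₂, E₀₃, E₁₃, C₀, C_P, hC₀, hC_P, hTS, hBS⟩ := twoSeq_eight₁₃
  obtain ⟨C₁, hC₁, hBu⟩ := abs_sum_copTauW_le'
  obtain ⟨C₂, hC₂, hAu⟩ := abs_sum_copTauW_le
  refine ⟨E₀₀, E₀₁, E₀₂, E₀₃, E₁₀, E₁₁, E₁₂, E₁₃, (∫ v in Set.Ioc (0 : ℝ) 1, Real.log v ^ 2 * (v / (1 + v ^ 2) ^ 2)),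
    (∫ v in Set.Ioc (0 : ℝ) 1, Real.log v ^ 4 * (v / (1 + v ^ 2) ^ 2)), fun P hP0 ↦ ?_⟩
  set SP : ℝ := ∑ i ∈ Finset.range (P.natDegree + 1), |P.coeff i| with hSP
  have hSP0 : 0 ≤ SP := Finset.sum_nonneg fun i _ ↦ abs_nonneg _
  -- the final constant
  set KKs : ℝ := C₀ * (243 * C₁ + 33 + 15) + C₀ * (3 + 6 * C_P + 4 * C_P ^ 2) with hKKs
  set KKt : ℝ := C₀ * (93312 * C₂ + 12672 * C₂ + 5760 * C₂) + C₀ * (1152 * C_P + 1216 * C_P ^ 2) with hKKt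
  have hKKs0 : 0 ≤ KKs := by positivity
  have hKKt0 : 0 ≤ KKt := by positivity
  set KK : ℝ := KKs + KKt with hKK
  have hKK0 : 0 ≤ KK := by positivity
  refine ⟨SP ^ 2 * KK + 1, by positivity, fun n g hn hg Q M hQ2 hM2 hnM hgM K₁ hK₁ ↦ ?_⟩
  -- notation and basic facts
  have hn0 : (0 : ℝ) < n := by exact_mod_cast Nat.pos_of_ne_zero hn
  have hg0 : (0 : ℝ) < g := by exact_mod_cast Nat.pos_of_ne_zero hg
  have hg1 : (1 : ℝ) ≤ g := by exact_mod_cast Nat.one_le_iff_ne_zero.2 hg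
  have hQ0 : 0 < Q := by linarith
  have hM0 : 0 < M := by linarith
  set Y : ℝ := M / n with hYdef
  set L : ℝ := Real.log M with hLdef
  set α : ℝ := (g : ℝ) ^ 2 / Q ^ 2 with hαdef
  have hα : 0 < α := by positivity
  have hY : 1 ≤ Y := by rw [hYdef, le_div_iff₀ hn0]; linarith
  have hY0 : 0 < Y := by linarith
  have hYM : Y ≤ M := div_le_self hM0.le (by exact_mod_cast Nat.one_le_iff_ne_zero.2 hn)
  have hL0 : 0 < L := Real.log_pos (by linarith)
  have hLY0 : 0 ≤ Real.log Y := Real.log_nonneg hY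
  have hLYL : Real.log Y ≤ L := Real.log_le_log hY0 hYM
  have hlogQ : 0 ≤ Real.log Q := Real.log_nonneg (by linarith)
  have hlogg0 : 0 ≤ Real.log g := Real.log_nonneg hg1
  have hloggM : Real.log g ≤ L := Real.log_le_log hg0 hgM
  set Lam : ℝ := 1 + 2 * Real.log M + Real.log Q with hLamdef
  have hLam1 : 1 ≤ Lam := by rw [hLamdef]; linarith
  have hLam0 : 0 < Lam := by linarith
  set β : ℝ := Real.log Q - Real.log g - Real.log Y with hβdef
  have hβ : |β| ≤ Lam := by
    rw [hβdef, hLamdef, abs_le]; constructor <;> linarith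
  have hLYLam : Real.log Y ≤ Lam := by rw [hLamdef]; linarith
  set ly : ℝ := 1 + Real.log Y with hlydef
  have hly0 : 0 ≤ ly := by rw [hlydef]; linarith
  have hly1 : 1 ≤ ly := by rw [hlydef]; linarith
  have h1LY : ly ≤ Lam := by rw [hlydef, hLamdef]; linarith
  set D : ℝ := divWeight n with hDdef
  have hD1 : 1 ≤ D := one_le_divWeight hn
  have hD0 : 0 ≤ D := divWeight_nonneg n
  set x : ℝ := 1 + |Real.log (2 * α * Y ^ 2)| with hxdef
  have hx1 : 1 ≤ x := by rw [hxdef]; linarith [abs_nonneg (Real.log (2 * α * Y ^ 2))]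
  have hx0 : 0 ≤ x := by linarith
  -- `x ≤ 2Lam`
  have hxLam : x ≤ 2 * Lam := by
    have hl2 : Real.log 2 < 1 := by have := Real.log_two_lt_d9; linarith
    have hl2' : 0 < Real.log 2 := Real.log_pos (by norm_num)
    have hlog : Real.log (2 * α * Y ^ 2) = Real.log 2 + (2 * Real.log g - 2 * Real.log Q) + 2 * Real.log Y := by
      rw [hαdef, Real.log_mul (by positivity) (by positivity), Real.log_mul (by norm_num) (by positivity),
        Real.log_pow, Real.log_div (by positivity) (by positivity), Real.log_pow, Real.log_pow]
      push_cast; ring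
    rw [hxdef, hlog, hLamdef]
    have := abs_le.2 (⟨by linarith, by linarith⟩ :
      -(1 + 4 * Real.log M + 2 * Real.log Q) ≤ Real.log 2 + (2 * Real.log g - 2 * Real.log Q) + 2 * Real.log Y ∧
        Real.log 2 + (2 * Real.log g - 2 * Real.log Q) + 2 * Real.log Y ≤ 1 + 4 * Real.log M + 2 * Real.log Q)
    linarith
  have hK0 : 0 ≤ Real.log (K₁ : ℝ) := Real.log_natCast_nonneg K₁
  set K12 : ℝ := (1 + Real.log (K₁ : ℝ)) ^ 12 with hK12def
  have hK12 : 0 < K12 := by positivity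
  set s : ℝ := Real.sqrt (2 * α * K₁ * Y) with hsdef
  have hs0 : 0 ≤ s := Real.sqrt_nonneg _
  -- the four envelopes
  set Ψ₀ : ℝ := D * (3 * C₀ * C₁ * ly ^ 2 * s + 18 * C₀ * C₂ * ly ^ 2 * x ^ 6 / K12) with hΨ₀
  set Ψ₂ : ℝ := 3 * C₀ * ly ^ 2 * ly ^ 4 * s + 18 * C₀ * C₂ * D * ly ^ 4 * x ^ 6 / K12 with hΨ₂
  set Ψ₄ : ℝ := 3 * C₀ * ly ^ 2 * (5 * ly ^ 6) * s + 18 * C₀ * C₂ * D * (5 * ly ^ 6) * x ^ 6 / K12 with hΨ₄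
  set ΨB : ℝ := C₀ * ((3 * (ly ^ 4 + C_P * D) * ly ^ 4 + 3 * (C_P * D) * (ly ^ 4 + C_P * D) + (C_P * D) ^ 2) * s +
      (18 * ly ^ 4 * (C_P * D) + 19 * (C_P * D) ^ 2) * x ^ 6 / K12) with hΨB
  have hΨ₀0 : 0 ≤ Ψ₀ := by positivity
  have hΨ₂0 : 0 ≤ Ψ₂ := by positivity
  have hΨ₄0 : 0 ≤ Ψ₄ := by positivity
  have hΨB0 : 0 ≤ ΨB := by positivity
  -- tails of the row sequence `a_n` (the log saving)
  have hηe : ∀ e : ℕ, K₁ ≤ e → |∑ k ∈ Icc 1 e, copTauW n k| ≤ C₂ * D / K12 := by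
    intro e he
    rcases Nat.eq_zero_or_pos e with rfl | he0
    · simp only [show Icc (1 : ℕ) 0 = ∅ from Finset.Icc_eq_empty (by norm_num), Finset.sum_empty, abs_zero]
      positivity
    · have h := hAu n hn (e : ℝ) (by exact_mod_cast he0)
      rw [Nat.floor_natCast] at h
      refine h.trans ?_
      have hle : Real.log (K₁ : ℝ) ≤ Real.log (e : ℝ) := by
        rcases Nat.eq_zero_or_pos K₁ with rfl | hK0'
        · simp only [Nat.cast_zero, Real.log_zero]; exact Real.log_natCast_nonneg e
        · exact Real.log_le_log (by exact_mod_cast hK0') (by exact_mod_cast he)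
      apply div_le_div_of_nonneg_left (by positivity) (by positivity)
      exact pow_le_pow_left₀ (by positivity) (by linarith) 12
  have hη0 : 0 ≤ C₂ * D / K12 := by positivity
  -- column data: undecorated, `P₂`-decorated, `3P₂²−2P₄`-decorated
  have hBa : ∀ e : ℕ, e ≤ ⌊Y⌋₊ → |∑ k ∈ Icc 1 e, copTauW n k| ≤ C₁ * D := by
    intro e _
    rcases Nat.eq_zero_or_pos e with rfl | he
    · simp only [show Icc (1 : ℕ) 0 = ∅ from Finset.Icc_eq_empty (by norm_num), Finset.sum_empty, abs_zero]
      positivity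
    · have := hBu n hn (e : ℝ) (by exact_mod_cast he)
      rwa [Nat.floor_natCast] at this
  have hBaP : ∀ e : ℕ, e ≤ ⌊Y⌋₊ → |∑ k ∈ Icc 1 e, copTauW n k * ∑ p ∈ k.primeFactors, Real.log p ^ 2| ≤ ly ^ 4 :=
    fun e he ↦ abs_sum_copTauW_primeSq_le n hY he
  have hBaD : ∀ e : ℕ, e ≤ ⌊Y⌋₊ → |∑ k ∈ Icc 1 e, copTauW n k *
      (3 * (∑ p ∈ k.primeFactors, Real.log p ^ 2) ^ 2 - 2 * ∑ p ∈ k.primeFactors, Real.log p ^ 4)| ≤ 5 * ly ^ 6 :=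
    fun e he ↦ abs_sum_copTauW_decorFour_le n hY he
  have hSa : ∀ m : ℕ, ∑ k ∈ Icc 1 ⌊Y⌋₊, |copTauW n k| * ellp Y k ^ m ≤ Real.log Y ^ m * ly ^ 2 :=
    fun m ↦ sum_abs_copTauW_mul_ellp_pow_le n m hY
  have hSaP : ∀ m : ℕ, ∑ k ∈ Icc 1 ⌊Y⌋₊, |copTauW n k * ∑ p ∈ k.primeFactors, Real.log p ^ 2| * ellp Y k ^ m ≤
      Real.log Y ^ m * ly ^ 4 := fun m ↦ sum_abs_copTauW_primeSq_ellp_pow_le n m hY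
  have hSaD : ∀ m : ℕ, ∑ k ∈ Icc 1 ⌊Y⌋₊, |copTauW n k *
      (3 * (∑ p ∈ k.primeFactors, Real.log p ^ 2) ^ 2 - 2 * ∑ p ∈ k.primeFactors, Real.log p ^ 4)| * ellp Y k ^ m ≤
      Real.log Y ^ m * (5 * ly ^ 6) := by
    intro m; have := sum_abs_copTauW_decorFour_ellp_pow_le n m hY; linarith
  -- (h0) undecorated monomials
  have h0 : ∀ R : ℝ → ℝ,
      (R = (fun y : ℝ ↦ ((∫ u₁ in Set.Ioi (0 : ℝ), ∫ u₂ in Set.Ioi (y / u₁),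
              Real.exp (-(u₁ + u₂)) / (1 - Real.exp (-(u₁ + u₂))) ^ 2) -
            (Real.log (1 / y) / 2 + E₀₀))) ∨
       R = (fun y : ℝ ↦ ((∫ u₁ in Set.Ioi (0 : ℝ), ∫ u₂ in Set.Ioi (y / u₁),
              Real.exp (-(u₁ + u₂)) / (1 - Real.exp (-(u₁ + u₂))) ^ 2 * Real.log u₂) -
            (-(Real.log (1 / y) ^ 2) / 8 + E₀₁))) ∨
       R = (fun y : ℝ ↦ ((∫ u₁ in Set.Ioi (0 : ℝ), Real.log u₁ * ∫ u₂ in Set.Ioi (y / u₁),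
              Real.exp (-(u₁ + u₂)) / (1 - Real.exp (-(u₁ + u₂))) ^ 2) -
            (-(Real.log (1 / y) ^ 2) / 8 + E₁₀))) ∨
       R = (fun y : ℝ ↦ ((∫ u₁ in Set.Ioi (0 : ℝ), ∫ u₂ in Set.Ioi (y / u₁),
              Real.exp (-(u₁ + u₂)) / (1 - Real.exp (-(u₁ + u₂))) ^ 2 * Real.log u₂ ^ 2) -
            (Real.log (1 / y) ^ 3 / 24 + 2 * (∫ v in Set.Ioc (0 : ℝ) 1, Real.log v ^ 2 * (v / (1 + v ^ 2) ^ 2)) * Real.log (1 / y) + E₀₂))) ∨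
       R = (fun y : ℝ ↦ ((∫ u₁ in Set.Ioi (0 : ℝ), Real.log u₁ * ∫ u₂ in Set.Ioi (y / u₁),
              Real.exp (-(u₁ + u₂)) / (1 - Real.exp (-(u₁ + u₂))) ^ 2 * Real.log u₂) -
            (Real.log (1 / y) ^ 3 / 24 - 2 * (∫ v in Set.Ioc (0 : ℝ) 1, Real.log v ^ 2 * (v / (1 + v ^ 2) ^ 2)) * Real.log (1 / y) + E₁₁))) ∨
       R = (fun y : ℝ ↦ ((∫ u₁ in Set.Ioi (0 : ℝ), Real.log u₁ * ∫ u₂ in Set.Ioi (y / u₁),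
              Real.exp (-(u₁ + u₂)) / (1 - Real.exp (-(u₁ + u₂))) ^ 2 * Real.log u₂ ^ 2) -
            (-(Real.log (1 / y) ^ 4) / 64 + (∫ v in Set.Ioc (0 : ℝ) 1, Real.log v ^ 2 * (v / (1 + v ^ 2) ^ 2)) * Real.log (1 / y) ^ 2 / 2 + E₁₂))) ∨
       R = (fun y : ℝ ↦ ((∫ u₁ in Set.Ioi (0 : ℝ), ∫ u₂ in Set.Ioi (y / u₁),
              Real.exp (-(u₁ + u₂)) / (1 - Real.exp (-(u₁ + u₂))) ^ 2 * Real.log u₂ ^ 3) -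
            (-(Real.log (1 / y) ^ 4) / 64 - 3 * (∫ v in Set.Ioc (0 : ℝ) 1, Real.log v ^ 2 * (v / (1 + v ^ 2) ^ 2)) / 2 * Real.log (1 / y) ^ 2 + E₀₃))) ∨
       R = (fun y : ℝ ↦ ((∫ u₁ in Set.Ioi (0 : ℝ), Real.log u₁ * ∫ u₂ in Set.Ioi (y / u₁),
              Real.exp (-(u₁ + u₂)) / (1 - Real.exp (-(u₁ + u₂))) ^ 2 * Real.log u₂ ^ 3) -
            (Real.log (1 / y) ^ 5 / 160 - 2 * (∫ v in Set.Ioc (0 : ℝ) 1, Real.log v ^ 4 * (v / (1 + v ^ 2) ^ 2)) * Real.log (1 / y) + E₁₃)))) →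
      ∀ i j : ℕ, 1 ≤ i → 1 ≤ j →
      |∑ k₁ ∈ Icc 1 ⌊Y⌋₊, ∑ k₂ ∈ Icc 1 ⌊Y⌋₊,
          copTauW n k₁ * copTauW n k₂ * ellp Y k₁ ^ i * ellp Y k₂ ^ j * R (α * k₁ * k₂)| ≤ Real.log Y ^ (i + j) * Ψ₀ := by
    intro R hRR i j hi hj
    refine (hTS R hRR (copTauW n) (copTauW n) Y α (C₁ * D) (C₂ * D / K12) K₁ i j hY hα hi hj hBa hηe hK₁).trans ?_
    have hLi : 0 ≤ Real.log Y ^ i := pow_nonneg hLY0 i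
    have hLj : 0 ≤ Real.log Y ^ j := pow_nonneg hLY0 j
    have p1 : 0 ≤ C₁ * D * (Real.log Y ^ j * (3 * C₀ * s)) := by positivity
    have p2 : 0 ≤ (2 * (C₂ * D / K12)) * (Real.log Y ^ i * (9 * C₀ * x ^ 6)) := by positivity
    calc _ ≤ (Real.log Y ^ i * ly ^ 2) * (C₁ * D * (Real.log Y ^ j * (3 * C₀ * s))) +
          (Real.log Y ^ j * ly ^ 2) * ((2 * (C₂ * D / K12)) * (Real.log Y ^ i * (9 * C₀ * x ^ 6))) :=
          add_le_add (mul_le_mul_of_nonneg_right (hSa i) p1) (mul_le_mul_of_nonneg_right (hSa j) p2)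
      _ = Real.log Y ^ (i + j) * Ψ₀ := by rw [hΨ₀, pow_add]; field_simp; ring
  -- (h2) `P₂`-decorated column
  have h2 : ∀ R : ℝ → ℝ,
      (R = (fun y : ℝ ↦ ((∫ u₁ in Set.Ioi (0 : ℝ), ∫ u₂ in Set.Ioi (y / u₁),
              Real.exp (-(u₁ + u₂)) / (1 - Real.exp (-(u₁ + u₂))) ^ 2 * Real.log u₂) -
            (-(Real.log (1 / y) ^ 2) / 8 + E₀₁))) ∨
       R = (fun y : ℝ ↦ ((∫ u₁ in Set.Ioi (0 : ℝ), Real.log u₁ * ∫ u₂ in Set.Ioi (y / u₁),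
              Real.exp (-(u₁ + u₂)) / (1 - Real.exp (-(u₁ + u₂))) ^ 2) -
            (-(Real.log (1 / y) ^ 2) / 8 + E₁₀))) ∨
       R = (fun y : ℝ ↦ ((∫ u₁ in Set.Ioi (0 : ℝ), ∫ u₂ in Set.Ioi (y / u₁),
              Real.exp (-(u₁ + u₂)) / (1 - Real.exp (-(u₁ + u₂))) ^ 2 * Real.log u₂ ^ 2) -
            (Real.log (1 / y) ^ 3 / 24 + 2 * (∫ v in Set.Ioc (0 : ℝ) 1, Real.log v ^ 2 * (v / (1 + v ^ 2) ^ 2)) * Real.log (1 / y) + E₀₂))) ∨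
       R = (fun y : ℝ ↦ ((∫ u₁ in Set.Ioi (0 : ℝ), Real.log u₁ * ∫ u₂ in Set.Ioi (y / u₁),
              Real.exp (-(u₁ + u₂)) / (1 - Real.exp (-(u₁ + u₂))) ^ 2 * Real.log u₂) -
            (Real.log (1 / y) ^ 3 / 24 - 2 * (∫ v in Set.Ioc (0 : ℝ) 1, Real.log v ^ 2 * (v / (1 + v ^ 2) ^ 2)) * Real.log (1 / y) + E₁₁)))) →
      ∀ i j : ℕ, 1 ≤ i → 1 ≤ j →
      |∑ k₁ ∈ Icc 1 ⌊Y⌋₊, ∑ k₂ ∈ Icc 1 ⌊Y⌋₊,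
          copTauW n k₁ * (copTauW n k₂ * ∑ p ∈ k₂.primeFactors, Real.log p ^ 2) * ellp Y k₁ ^ i * ellp Y k₂ ^ j *
            R (α * k₁ * k₂)| ≤ Real.log Y ^ (i + j) * Ψ₂ := by
    intro R hRR i j hi hj
    have hRR' : R = (fun y : ℝ ↦ ((∫ u₁ in Set.Ioi (0 : ℝ), ∫ u₂ in Set.Ioi (y / u₁),
              Real.exp (-(u₁ + u₂)) / (1 - Real.exp (-(u₁ + u₂))) ^ 2) -
            (Real.log (1 / y) / 2 + E₀₀))) ∨
       R = (fun y : ℝ ↦ ((∫ u₁ in Set.Ioi (0 : ℝ), ∫ u₂ in Set.Ioi (y / u₁),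
              Real.exp (-(u₁ + u₂)) / (1 - Real.exp (-(u₁ + u₂))) ^ 2 * Real.log u₂) -
            (-(Real.log (1 / y) ^ 2) / 8 + E₀₁))) ∨
       R = (fun y : ℝ ↦ ((∫ u₁ in Set.Ioi (0 : ℝ), Real.log u₁ * ∫ u₂ in Set.Ioi (y / u₁),
              Real.exp (-(u₁ + u₂)) / (1 - Real.exp (-(u₁ + u₂))) ^ 2) -
            (-(Real.log (1 / y) ^ 2) / 8 + E₁₀))) ∨
       R = (fun y : ℝ ↦ ((∫ u₁ in Set.Ioi (0 : ℝ), ∫ u₂ in Set.Ioi (y / u₁),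
              Real.exp (-(u₁ + u₂)) / (1 - Real.exp (-(u₁ + u₂))) ^ 2 * Real.log u₂ ^ 2) -
            (Real.log (1 / y) ^ 3 / 24 + 2 * (∫ v in Set.Ioc (0 : ℝ) 1, Real.log v ^ 2 * (v / (1 + v ^ 2) ^ 2)) * Real.log (1 / y) + E₀₂))) ∨
       R = (fun y : ℝ ↦ ((∫ u₁ in Set.Ioi (0 : ℝ), Real.log u₁ * ∫ u₂ in Set.Ioi (y / u₁),
              Real.exp (-(u₁ + u₂)) / (1 - Real.exp (-(u₁ + u₂))) ^ 2 * Real.log u₂) -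
            (Real.log (1 / y) ^ 3 / 24 - 2 * (∫ v in Set.Ioc (0 : ℝ) 1, Real.log v ^ 2 * (v / (1 + v ^ 2) ^ 2)) * Real.log (1 / y) + E₁₁))) ∨
       R = (fun y : ℝ ↦ ((∫ u₁ in Set.Ioi (0 : ℝ), Real.log u₁ * ∫ u₂ in Set.Ioi (y / u₁),
              Real.exp (-(u₁ + u₂)) / (1 - Real.exp (-(u₁ + u₂))) ^ 2 * Real.log u₂ ^ 2) -
            (-(Real.log (1 / y) ^ 4) / 64 + (∫ v in Set.Ioc (0 : ℝ) 1, Real.log v ^ 2 * (v / (1 + v ^ 2) ^ 2)) * Real.log (1 / y) ^ 2 / 2 + E₁₂))) ∨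
       R = (fun y : ℝ ↦ ((∫ u₁ in Set.Ioi (0 : ℝ), ∫ u₂ in Set.Ioi (y / u₁),
              Real.exp (-(u₁ + u₂)) / (1 - Real.exp (-(u₁ + u₂))) ^ 2 * Real.log u₂ ^ 3) -
            (-(Real.log (1 / y) ^ 4) / 64 - 3 * (∫ v in Set.Ioc (0 : ℝ) 1, Real.log v ^ 2 * (v / (1 + v ^ 2) ^ 2)) / 2 * Real.log (1 / y) ^ 2 + E₀₃))) ∨
       R = (fun y : ℝ ↦ ((∫ u₁ in Set.Ioi (0 : ℝ), Real.log u₁ * ∫ u₂ in Set.Ioi (y / u₁),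
              Real.exp (-(u₁ + u₂)) / (1 - Real.exp (-(u₁ + u₂))) ^ 2 * Real.log u₂ ^ 3) -
            (Real.log (1 / y) ^ 5 / 160 - 2 * (∫ v in Set.Ioc (0 : ℝ) 1, Real.log v ^ 4 * (v / (1 + v ^ 2) ^ 2)) * Real.log (1 / y) + E₁₃))) := by
      rcases hRR with h | h | h | h
      · exact Or.inr (Or.inl h)
      · exact Or.inr (Or.inr (Or.inl h))
      · exact Or.inr (Or.inr (Or.inr (Or.inl h)))
      · exact Or.inr (Or.inr (Or.inr (Or.inr (Or.inl h))))
    refine (hTS R hRR' (copTauW n) (fun k ↦ copTauW n k * ∑ p ∈ k.primeFactors, Real.log p ^ 2) Y α (ly ^ 4)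
      (C₂ * D / K12) K₁ i j hY hα hi hj hBaP hηe hK₁).trans ?_
    have hLi : 0 ≤ Real.log Y ^ i := pow_nonneg hLY0 i
    have hLj : 0 ≤ Real.log Y ^ j := pow_nonneg hLY0 j
    have p1 : 0 ≤ ly ^ 4 * (Real.log Y ^ j * (3 * C₀ * s)) := by positivity
    have p2 : 0 ≤ (2 * (C₂ * D / K12)) * (Real.log Y ^ i * (9 * C₀ * x ^ 6)) := by positivity
    calc _ ≤ (Real.log Y ^ i * ly ^ 2) * (ly ^ 4 * (Real.log Y ^ j * (3 * C₀ * s))) +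
          (Real.log Y ^ j * ly ^ 4) * ((2 * (C₂ * D / K12)) * (Real.log Y ^ i * (9 * C₀ * x ^ 6))) :=
          add_le_add (mul_le_mul_of_nonneg_right (hSa i) p1) (mul_le_mul_of_nonneg_right (hSaP j) p2)
      _ = Real.log Y ^ (i + j) * Ψ₂ := by rw [hΨ₂, pow_add]; field_simp; ring
  -- (h4) `3P₂²−2P₄`-decorated column
  have h4 : ∀ i j : ℕ, 1 ≤ i → 1 ≤ j →
      |∑ k₁ ∈ Icc 1 ⌊Y⌋₊, ∑ k₂ ∈ Icc 1 ⌊Y⌋₊,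
          copTauW n k₁ * (copTauW n k₂ * (3 * (∑ p ∈ k₂.primeFactors, Real.log p ^ 2) ^ 2 - 2 * ∑ p ∈ k₂.primeFactors, Real.log p ^ 4)) *
            ellp Y k₁ ^ i * ellp Y k₂ ^ j * (fun y : ℝ ↦ (∫ u₁ in Set.Ioi (0 : ℝ), ∫ u₂ in Set.Ioi (y / u₁),
              Real.exp (-(u₁ + u₂)) / (1 - Real.exp (-(u₁ + u₂))) ^ 2) -
            (Real.log (1 / y) / 2 + E₀₀)) (α * k₁ * k₂)| ≤ Real.log Y ^ (i + j) * Ψ₄ := by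
    intro i j hi hj
    refine (hTS _ (Or.inl rfl) (copTauW n)
      (fun k ↦ copTauW n k * (3 * (∑ p ∈ k.primeFactors, Real.log p ^ 2) ^ 2 - 2 * ∑ p ∈ k.primeFactors, Real.log p ^ 4))
      Y α (5 * ly ^ 6) (C₂ * D / K12) K₁ i j hY hα hi hj hBaD hηe hK₁).trans ?_
    have hLi : 0 ≤ Real.log Y ^ i := pow_nonneg hLY0 i
    have hLj : 0 ≤ Real.log Y ^ j := pow_nonneg hLY0 j
    have p1 : 0 ≤ 5 * ly ^ 6 * (Real.log Y ^ j * (3 * C₀ * s)) := by positivity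
    have p2 : 0 ≤ (2 * (C₂ * D / K12)) * (Real.log Y ^ i * (9 * C₀ * x ^ 6)) := by positivity
    calc _ ≤ (Real.log Y ^ i * ly ^ 2) * (5 * ly ^ 6 * (Real.log Y ^ j * (3 * C₀ * s))) +
          (Real.log Y ^ j * (5 * ly ^ 6)) * ((2 * (C₂ * D / K12)) * (Real.log Y ^ i * (9 * C₀ * x ^ 6))) :=
          add_le_add (mul_le_mul_of_nonneg_right (hSa i) p1) (mul_le_mul_of_nonneg_right (hSaD j) p2)
      _ = Real.log Y ^ (i + j) * Ψ₄ := by rw [hΨ₄, pow_add]; field_simp; ring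
  -- (hB) the both-sided monomial
  have hB : ∀ i j : ℕ, 1 ≤ i → 1 ≤ j →
      |∑ k₁ ∈ Icc 1 ⌊Y⌋₊, ∑ k₂ ∈ Icc 1 ⌊Y⌋₊,
          (copTauW n k₁ * ∑ p ∈ k₁.primeFactors, Real.log p ^ 2) * (copTauW n k₂ * ∑ p ∈ k₂.primeFactors, Real.log p ^ 2) *
            ellp Y k₁ ^ i * ellp Y k₂ ^ j * (fun y : ℝ ↦ (∫ u₁ in Set.Ioi (0 : ℝ), ∫ u₂ in Set.Ioi (y / u₁),
              Real.exp (-(u₁ + u₂)) / (1 - Real.exp (-(u₁ + u₂))) ^ 2) -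
            (Real.log (1 / y) / 2 + E₀₀)) (α * k₁ * k₂)| ≤ Real.log Y ^ (i + j) * ΨB := by
    intro i j hi hj
    have h := hBS n hn Y α K₁ i j hY hα hi hj hK₁
    rw [hΨB]
    exact h
  -- the abstract bookkeeping
  have key := abs_profile_weight_le₁₃ P hP0 hY hLam1 hβ hLYLam hΨ₀0 hΨ₂0 hΨ₄0 hΨB0 hL0 hLYL h0 h2 h4 hB
  -- the weight in `β`-form
  have hLk : ∀ k₁ ∈ Icc 1 ⌊Y⌋₊, ∀ k₂ ∈ Icc 1 ⌊Y⌋₊,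
      2 * (Real.log Q - Real.log g) - Real.log k₁ - Real.log k₂ = 2 * β + ellp Y k₁ + ellp Y k₂ := by
    intro k₁ hk₁ k₂ hk₂
    have h1 : (0 : ℝ) < k₁ := by exact_mod_cast (Finset.mem_Icc.1 hk₁).1
    have h2 : (0 : ℝ) < k₂ := by exact_mod_cast (Finset.mem_Icc.1 hk₂).1
    rw [ellp_eq_log hY0.le hk₁, ellp_eq_log hY0.le hk₂, Real.log_div hY0.ne' h1.ne', Real.log_div hY0.ne' h2.ne',
      hβdef]
    ring
  refine le_trans (le_of_eq ?_) (key.trans ?_)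
  · congr 1
    refine Finset.sum_congr rfl fun k₁ hk₁ ↦ Finset.sum_congr rfl fun k₂ hk₂ ↦ ?_
    rw [hLk k₁ hk₁ k₂ hk₂]
    ring
  -- the envelope arithmetic: everything `≤ KK·D²·Λ¹²·(s + 1/K12)`
  have hfin1 : 81 * Lam ^ 4 * Ψ₀ + 11 * Lam ^ 2 * Ψ₂ + Ψ₄ + ΨB ≤
      KKs * (D ^ 2 * (Lam ^ 12 * s)) + KKt * (D ^ 2 * (Lam ^ 12 / K12)) := by
    rw [hΨ₀, hΨ₂, hΨ₄, hΨB, hKKs, hKKt]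
    exact envelope_arith₂₂ hD1 hLam1 hly0 h1LY hx0 hxLam hs0 hK12 hC₀ hC₀ hC₁.le hC₂.le hC_P
  have hA0 : 0 ≤ D ^ 2 * (Lam ^ 12 * s) := by positivity
  have hB0 : 0 ≤ D ^ 2 * (Lam ^ 12 / K12) := by positivity
  have hfin : SP ^ 2 * (81 * Lam ^ 4 * Ψ₀ + 11 * Lam ^ 2 * Ψ₂ + Ψ₄ + ΨB) ≤
      SP ^ 2 * (KK * (D ^ 2 * (Lam ^ 12 * s) + D ^ 2 * (Lam ^ 12 / K12))) := by
    apply mul_le_mul_of_nonneg_left _ (sq_nonneg SP)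
    refine hfin1.trans ?_
    rw [hKK]
    linarith only [mul_nonneg hKKs0 hB0, mul_nonneg hKKt0 hA0]
  have hSP2 : 0 ≤ SP ^ 2 := sq_nonneg SP
  calc SP ^ 2 * (81 * Lam ^ 4 * Ψ₀ + 11 * Lam ^ 2 * Ψ₂ + Ψ₄ + ΨB)
      ≤ SP ^ 2 * (KK * (D ^ 2 * (Lam ^ 12 * s) + D ^ 2 * (Lam ^ 12 / K12))) := hfin
    _ = SP ^ 2 * KK * D ^ 2 * (Lam ^ 12 * s + Lam ^ 12 / K12) := by ring
    _ ≤ (SP ^ 2 * KK + 1) * D ^ 2 * (Lam ^ 12 * s + Lam ^ 12 / K12) := by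
        have : 0 ≤ D ^ 2 * (Lam ^ 12 * s + Lam ^ 12 / K12) := by positivity
        linarith only [this]
    _ = (SP ^ 2 * KK + 1) * divWeight n ^ 2 * (Lam ^ 12 * Real.sqrt (2 * α * K₁ * Y) + Lam ^ 12 / K12) := by
        rw [hDdef, hsdef]

end Summit.Parity.GeneralizedHardyLittlewood.Theorems.MomentsBeyondDiagonal.DiagCorner

end
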